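import Literature.Barriers.FinalStateConjecture.KleinGordonModeConstruction
import Mathlib.Analysis.SpecialFunctions.Log.Basic
import HarnessLib

/-!
# Barrier catalogue `FinalStateConjecture`: Shlapentokh-Rothman's unstable Klein–Gordon modes —
# the horizon flux of a mode in the upper half plane vanishes
(`Literature/Barriers/FinalStateConjecture/`, D-0021, D-0014; family `gr`; namespace
`Literature.Barriers.FinalStateConjecture`)

Shlapentokh-Rothman, Comm. Math. Phys. 329 (2014), §2 (2.3) and proof of Prop. 4.6
("For `ε > 0` we have `Q̃_T(∞) = Q̃_T(r₊) = 0`"): a solution of the radial ODE of the horizon form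
(2.3), `R = e^{-i(ωt̄(r) - mφ̄(r))} f(r)` with `f` of class `C¹` up to and across `r₊`, satisfies,
when `Im ω > 0`, `Δ R' R̄ → 0` as `r → r₊⁺`: indeed `Δ R' R̄ = |e^{-i(ωt̄ - mφ̄)}|² (Δ f' - iK f) f̄`
with `K = ω(r² + a²) - am` (`Δ t̄' = r² + a²`, `Δ φ̄' = a`), the bracket is bounded near `r₊`, and
`|e^{-i(ωt̄ - mφ̄)}|² = e^{2 Im(ω) t̄(r)} → 0` because `t̄(r) = r + (2Mr₊/(r₊-r₋)) log(r - r₊) - … → -∞`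
(`Kerr.starTime`). This is the horizon boundary input of `superradiant_of_isRadialSolution`
(`KleinGordonRadialCurrent.lean`) in the form delivered by `ShlapentokhRothman2014_separatedMode` /
the horizon-regular mode construction. Everything is proved.

## References

* Y. Shlapentokh-Rothman, Comm. Math. Phys. 329 (2014) 859–891, arXiv:1302.3448: §1.2.1
  (`t̄`, `φ̄`), §2 (2.3), §4.4 proof of Prop. 4.6 (held copy `paper:arxiv-1302.3448`, pp. 4, 7, 12).
  Key `ShlapentokhRothman2014KleinGordon`.
-/

noncomputable section

open Set Filter
open scoped Topology Real ContDiff ComplexConjugate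

namespace Literature.Barriers.FinalStateConjecture

open Literature.Geometry.Lorentzian

variable {M a : ℝ}

/-- **`t̄(r) → -∞` as `r → r₊⁺`** (`t̄ = r + (2Mr₊/(r₊-r₋)) log(r - r₊) - (2Mr₋/(r₊-r₋)) log(r - r₋)`,
`2Mr₊/(r₊-r₋) > 0`). [cite: ShlapentokhRothman2014KleinGordon, §1.2.1] -/
theorem tendsto_starTime_nhdsGT (hMa : Kerr.IsSubextremal M a) :
    Tendsto (Kerr.starTime M a) (𝓝[>] (Kerr.rPlus M a)) atBot := by
  have hpm : 0 < Kerr.rPlus M a - Kerr.rMinus M a := sub_pos.2 hMa.rMinus_lt_rPlus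
  have hA : 0 < 2 * M * Kerr.rPlus M a / (Kerr.rPlus M a - Kerr.rMinus M a) :=
    div_pos (by nlinarith [hMa.pos, hMa.rPlus_pos]) hpm
  -- the regular part is continuous at `r₊`
  have hreg : Tendsto (fun r ↦ r - 2 * M * Kerr.rMinus M a / (Kerr.rPlus M a - Kerr.rMinus M a) *
      Real.log (r - Kerr.rMinus M a)) (𝓝[>] (Kerr.rPlus M a))
      (𝓝 (Kerr.rPlus M a - 2 * M * Kerr.rMinus M a / (Kerr.rPlus M a - Kerr.rMinus M a) *
        Real.log (Kerr.rPlus M a - Kerr.rMinus M a))) := by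
    have hc : ContinuousAt (fun r ↦ r - 2 * M * Kerr.rMinus M a / (Kerr.rPlus M a - Kerr.rMinus M a) *
        Real.log (r - Kerr.rMinus M a)) (Kerr.rPlus M a) := by
      have h1 : ContinuousAt (fun r : ℝ ↦ Real.log (r - Kerr.rMinus M a)) (Kerr.rPlus M a) :=
        (continuousAt_id.sub continuousAt_const).log hpm.ne'
      exact continuousAt_id.sub (continuousAt_const.mul h1)
    exact hc.tendsto.mono_left nhdsWithin_le_nhds
  -- the singular part tends to `-∞`
  have hsub : Tendsto (fun r : ℝ ↦ r - Kerr.rPlus M a) (𝓝[>] (Kerr.rPlus M a)) (𝓝[>] 0) := by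
    refine tendsto_nhdsWithin_iff.2 ⟨?_, ?_⟩
    · have : Tendsto (fun r : ℝ ↦ r - Kerr.rPlus M a) (𝓝 (Kerr.rPlus M a))
          (𝓝 (Kerr.rPlus M a - Kerr.rPlus M a)) := tendsto_id.sub_const _
      rw [sub_self] at this
      exact this.mono_left nhdsWithin_le_nhds
    · filter_upwards [self_mem_nhdsWithin] with r hr using sub_pos.2 (mem_Ioi.1 hr)
  have hlog : Tendsto (fun r : ℝ ↦ Real.log (r - Kerr.rPlus M a)) (𝓝[>] (Kerr.rPlus M a)) atBot :=
    Real.tendsto_log_nhdsGT_zero.comp hsub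
  have hsing : Tendsto (fun r : ℝ ↦ 2 * M * Kerr.rPlus M a / (Kerr.rPlus M a - Kerr.rMinus M a) *
      Real.log (r - Kerr.rPlus M a)) (𝓝[>] (Kerr.rPlus M a)) atBot :=
    hlog.const_mul_atBot hA
  have hsum := hreg.add_atBot hsing
  refine hsum.congr fun r ↦ ?_
  simp only [Kerr.starTime]
  ring

/-- **The squared modulus of the horizon phase**: `|e^{-i(ωt̄ - mφ̄)}|² = e^{2 Im(ω) t̄}` (`t̄`, `φ̄`,
`m` real). [folklore] -/
theorem norm_sq_horizonPhase (w : ℂ) (m : ℤ) (T P : ℝ) :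
    ‖Complex.exp (-(Complex.I * (w * (T : ℂ) - (m : ℂ) * (P : ℂ))))‖ ^ 2 =
      Real.exp (2 * w.im * T) := by
  rw [Complex.norm_exp, ← Real.exp_nat_mul]
  congr 1
  simp only [Complex.neg_re, Complex.mul_re, Complex.I_re, Complex.I_im, Complex.sub_re,
    Complex.sub_im, Complex.mul_im, Complex.ofReal_re, Complex.ofReal_im, Complex.intCast_re,
    Complex.intCast_im]
  push_cast
  ring

/-- **The horizon flux of an upper-half-plane mode vanishes.** Let `(M, a)` be sub-extremal,
`Im ω > 0`, and let `R = e^{-i(ωt̄ - mφ̄)} f` on `(r₊, ∞)` with `f` of class `C¹` on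
`(r₊ - η, ∞)`, `η > 0` (the horizon form (2.3)). Then `Δ R' R̄ → 0` as `r → r₊⁺`
(`Δ R' R̄ = e^{2 Im(ω) t̄} (Δ f' - i(ω(r²+a²) - am) f) f̄`, a bounded function times
`e^{2 Im(ω) t̄(r)} → 0`). Shlapentokh-Rothman, CMP 329 (2014), proof of Prop. 4.6
("`Q̃_T(r₊) = 0` for `ε > 0`"). [cite: ShlapentokhRothman2014KleinGordon, Prop. 4.6 (proof) and §2 (2.3)] -/
theorem tendsto_horizonFlux_of_horizonForm (hMa : Kerr.IsSubextremal M a) {w : ℂ} (hw : 0 < w.im)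
    (m : ℤ) {R f : ℝ → ℂ} {η : ℝ} (hη : 0 < η)
    (hf : ContDiffOn ℝ 1 f (Ioi (Kerr.rPlus M a - η)))
    (hRf : ∀ r ∈ Ioi (Kerr.rPlus M a), R r =
      Complex.exp (-(Complex.I * (w * ((Kerr.starTime M a r : ℝ) : ℂ) -
        (m : ℂ) * ((Kerr.starAngle M a r : ℝ) : ℂ)))) * f r) :
    Tendsto (fun r : ℝ ↦ ((Kerr.delta M a r : ℝ) : ℂ) * deriv R r * conj (R r))
      (𝓝[>] (Kerr.rPlus M a)) (𝓝 0) := by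
  set rp := Kerr.rPlus M a with hrp
  -- the phase and its derivative on `(r₊, ∞)`
  set P : ℝ → ℂ := fun r ↦ Complex.exp (-(Complex.I * (w * ((Kerr.starTime M a r : ℝ) : ℂ) -
    (m : ℂ) * ((Kerr.starAngle M a r : ℝ) : ℂ)))) with hPdef
  set K : ℝ → ℂ := fun r ↦ w * (((r ^ 2 + a ^ 2 : ℝ)) : ℂ) - (m : ℂ) * (a : ℂ) with hKdef
  have hPd : ∀ r, rp < r → HasDerivAt P (P r * (-(Complex.I * K r) / ((Kerr.delta M a r : ℝ) : ℂ))) r := by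
    intro r hr
    have hΔ : ((Kerr.delta M a r : ℝ) : ℂ) ≠ 0 := Complex.ofReal_ne_zero.2 (Kerr.delta_pos hMa.le hr).ne'
    have h1 := (Kerr.hasDerivAt_starTime hMa hr).ofReal_comp
    have h2 := (Kerr.hasDerivAt_starAngle hMa hr).ofReal_comp
    have h3 := ((h1.const_mul w).sub (h2.const_mul (m : ℂ))).const_mul Complex.I
    have h4 := h3.neg.cexp
    refine h4.congr_deriv ?_
    simp only [hPdef, hKdef, Pi.neg_apply, Pi.sub_apply]
    push_cast
    field_simp
  -- `f` and `f'` near `r₊`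
  have hfd : ∀ r, rp < r → HasDerivAt f (deriv f r) r := fun r hr ↦
    ((hf.differentiableOn one_ne_zero).differentiableAt (Ioi_mem_nhds (by linarith))).hasDerivAt
  -- the derivative of `R` on `(r₊, ∞)`
  have hRd : ∀ r, rp < r → deriv R r =
      P r * (-(Complex.I * K r) / ((Kerr.delta M a r : ℝ) : ℂ)) * f r + P r * deriv f r := by
    intro r hr
    have heq : R =ᶠ[𝓝 r] fun s ↦ P s * f s := by
      filter_upwards [Ioi_mem_nhds hr] with s hs using hRf s hs
    rw [heq.deriv_eq]
    exact ((hPd r hr).mul (hfd r hr)).deriv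
  -- the identity `Δ R' R̄ = |P|² (Δ f' - iK f) f̄`
  have hid : ∀ r, rp < r → ((Kerr.delta M a r : ℝ) : ℂ) * deriv R r * conj (R r) =
      ((‖P r‖ ^ 2 : ℝ) : ℂ) * ((((Kerr.delta M a r : ℝ) : ℂ) * deriv f r - Complex.I * K r * f r) *
        conj (f r)) := by
    intro r hr
    have hΔ : ((Kerr.delta M a r : ℝ) : ℂ) ≠ 0 := Complex.ofReal_ne_zero.2 (Kerr.delta_pos hMa.le hr).ne'
    have hPP : ((‖P r‖ ^ 2 : ℝ) : ℂ) = P r * conj (P r) := by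
      rw [Complex.mul_conj, Complex.normSq_eq_norm_sq]
    rw [hRd r hr, hRf r hr, hPP, map_mul]
    field_simp
    ring
  -- `|P|² = e^{2 Im ω t̄} → 0`
  have hP2 : ∀ r, ‖P r‖ ^ 2 = Real.exp (2 * w.im * Kerr.starTime M a r) := fun r ↦
    norm_sq_horizonPhase w m _ _
  have hexp : Tendsto (fun r ↦ ‖P r‖ ^ 2) (𝓝[>] rp) (𝓝 0) := by
    have h1 : Tendsto (fun r ↦ 2 * w.im * Kerr.starTime M a r) (𝓝[>] rp) atBot :=
      (tendsto_starTime_nhdsGT hMa).const_mul_atBot (by positivity)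
    have h2 := Real.tendsto_exp_atBot.comp h1
    exact h2.congr fun r ↦ (hP2 r).symm
  -- the bracket is bounded near `r₊`
  have hcontf : ContinuousOn f (Icc rp (rp + 1)) :=
    hf.continuousOn.mono fun r hr ↦ by simp only [mem_Ioi]; linarith [hr.1]
  have hcontf' : ContinuousOn (deriv f) (Icc rp (rp + 1)) :=
    (hf.continuousOn_deriv_of_isOpen isOpen_Ioi le_rfl).mono fun r hr ↦ by
      simp only [mem_Ioi]; linarith [hr.1]
  have hcontB : ContinuousOn (fun r ↦ (((Kerr.delta M a r : ℝ) : ℂ) * deriv f r -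
      Complex.I * K r * f r) * conj (f r)) (Icc rp (rp + 1)) := by
    have hΔc : Continuous fun r : ℝ ↦ ((Kerr.delta M a r : ℝ) : ℂ) := by
      unfold Kerr.delta; fun_prop
    have hKc : Continuous K := by simp only [hKdef]; fun_prop
    refine ContinuousOn.mul ?_ (hcontf.star)
    exact (hΔc.continuousOn.mul hcontf').sub ((continuousOn_const.mul hKc.continuousOn).mul hcontf)
  obtain ⟨C, hC⟩ := isCompact_Icc.exists_bound_of_continuousOn hcontB
  -- squeeze
  have hbound : ∀ᶠ r in 𝓝[>] rp, ‖((Kerr.delta M a r : ℝ) : ℂ) * deriv R r * conj (R r)‖ ≤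
      C * ‖P r‖ ^ 2 := by
    have hmem : Ioo rp (rp + 1) ∈ 𝓝[>] rp := Ioo_mem_nhdsGT (by linarith)
    filter_upwards [hmem] with r hr
    rw [hid r hr.1, norm_mul, Complex.norm_real, Real.norm_eq_abs, abs_of_nonneg (sq_nonneg _),
      mul_comm]
    exact mul_le_mul_of_nonneg_right (hC r (Ioo_subset_Icc_self hr)) (sq_nonneg _)
  have hlim : Tendsto (fun r ↦ C * ‖P r‖ ^ 2) (𝓝[>] rp) (𝓝 0) := by
    simpa using hexp.const_mul C
  exact squeeze_zero_norm' hbound hlim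

end Literature.Barriers.FinalStateConjecture

end
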